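import Mathlib
import Summits.ValiantsHypothesis.ValiantsHypothesis.Theorems.FifoMatchingNNDivisionHardShortArcGeneric
import Summits.ValiantsHypothesis.ValiantsHypothesis.Theorems.FifoMatchingNNDivisionHardArcFaces
import HarnessLib

/-!
# Route FifoMatching — crux `NNDivisionHard` (stmt-ValiantsHypothesis-21181): the SPLIT FACE OF AN AVOIDING FAMILY —
# the block-recursion engine for faces `NN_n^{¬I}`, and the MIXED tier (left-short ∪ crossing ∪ right-avoidable arc sets)

`…SplitFace.topComponent_lWeight`: `top_{𝟙_L}(NN_{b+c}) = ι_L(NN_b) · ι_R(NN_c)`.  For an ARBITRARY arc set `I` the same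
direction applied to the `I`-avoiding face gives (crossing arcs of `I` never occur in a block-stable matching)

  `top_{𝟙_L}(NN_{b+c}^{¬I}) = ι_L(NN_b^{¬I_L}) · ι_R(NN_c^{¬I_R})`,

`I_L`, `I_R` the arcs of `I` internal to the left / right block in local coordinates — as soon as each block has a nest-free
perfect matching avoiding its part.  Projecting the right block away (Bürgisser):

* `glue2_avoids_iff` — a gluing avoids `I` iff its halves avoid `I_L`, `I_R`;
* ★★ `topComponent_lWeight_avoidingFace` — the identity above;
* ★★ `complexity_faceL_le`, `complexity_faceR_le` — **`L₊(NN_b^{¬I_L}) ≤ L₊(NN_{b+c}^{¬I}) + 3` and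
  `L₊(NN_c^{¬I_R}) ≤ L₊(NN_{b+c}^{¬I}) + 3`**: ONE STEP OF THE BLOCK RECURSION for avoiding faces (the arcs of `I` crossing
  `2b` disappear, the arcs inside the discarded block cost only the existence of one avoiding matching there);
* ★★ `mixedFace_exp_lower_bound` — **eventually in `b`: for every `c` and every arc set `I` of `[0, 2(b+c))` whose
  LEFT-internal arcs are short at scale `b` (`(j − i)³ ≤ b²`) and whose RIGHT-internal arcs are avoided by some nest-free
  perfect matching of the right block (crossing arcs: unrestricted), `2^{b^{1/6}} ≤ L₊(NN_{b+c}^{¬I}) + 4`**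
  (`…ShortArcGeneric.shortFaces_exp_lower_bound` at size `b` after one recursion step);
* ★★ `mixedGeneric_not_certificate_qp` — for every `c₀`, eventually in `n`: a cofactor whose outer face `top_{𝟙_{I^c}} h` is a
  single monomial for some such MIXED arc set `I` with `b ≥ c` (left block at least half) is not a certificate:
  `2^((log₂ n + c₀)^c₀) < L₊(NN_n · h) + L₊(h)`.

What a full recursion still needs (NOT done here): an existence lemma «`|I| ≤ k` and `b ≫ k` ⇒ some nest-free perfect matching
of `[0, 2b)` avoids `I`» and the bookkeeping of nested block embeddings; with it, every face avoiding a bounded number of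
arbitrary arcs — hence every positive power sum of boundedly many perfect matchings led by a nest-free one — would follow.
HONEST FRAMING: an engine and one more decided shape for ONE candidate family; stmt-21181 stays OPEN; nothing here bears on
`NNNotVP` or on VP ≠ VNP (NOT proved).  No definitions, no named facts.
References: Chen–Deng–Du–Stanley–Yan 2007 §1 [ChenDengDuStanleyYan2007]; Bürgisser 2000 Rem. 2.7 [Burgisser2000];
Hrubeš–Yehudayoff 2021 §6 Problem 2 [HrubesYehudayoff2021].
-/

noncomputable section

-- Sub = Summit single-conjunct layout: the duplicated namespace component is mandated by the tree.
set_option linter.dupNamespace false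
set_option autoImplicit false

namespace Summit.ValiantsHypothesis.ValiantsHypothesis.Theorems.FifoMatching.NNDivisionHard.SplitFaceAvoiding

open Finset MvPolynomial Literature.Computability.AlgebraicComplexity
open Summit.ValiantsHypothesis.ValiantsHypothesis.Theorems.ZeroOneTransfer.Negative (topComponent)
open Summit.ValiantsHypothesis.ValiantsHypothesis.Theorems.FifoMatching.NNDivisionHard.StackPowersQueue
  (blockEmb blockEmb_injective topComponent_sum_arcMonomial shiftMatching shiftMatching_mem)
open Summit.ValiantsHypothesis.ValiantsHypothesis.Theorems.FifoMatching.NNDivisionHard.LinearTransport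
  (complexity_le_of_vars_outside)
open Summit.ValiantsHypothesis.ValiantsHypothesis.Theorems.FifoMatching.NNDivisionHard.SplitFace
  (lWeight shiftR blockEmbR two_mul_le val_shiftR blockEmbR_injective topComponent_lWeight weight_le weight_eq_iff glue2
    glue2_mem glue2_stable glue2_castLE glue2_shiftR eq_castLE_or_eq_shiftR filter_max_eq_image glue2_injective2
    arcMonomial_glue2 support_rename_blockEmbR_outside support_rename_blockEmb_outside)
open Summit.ValiantsHypothesis.ValiantsHypothesis.Theorems.FifoMatching.NNDivisionHard.ArcElimination
  (complexity_avoidingFace_le_of_top_monomial)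
open Summit.ValiantsHypothesis.ValiantsHypothesis.Theorems.FifoMatching.NNDivisionHard.BinomialPowers
  (absorb_arith absorb_exp)
open Summit.ValiantsHypothesis.ValiantsHypothesis.Theorems.FifoMatching.NNDivisionHard.ShortArcGeneric
  (shift_avoids_short shortFaces_exp_lower_bound)
open Summit.ValiantsHypothesis.ValiantsHypothesis.Theorems.FifoMatching.NNDivisionHard.ArcFaces
  (polylog_lt_rpow_half_eventually)
open scoped NNReal BigOperators

/-! ### §1 Gluings and avoided arcs -/

section Split

variable {b c : ℕ}

/-- A gluing avoids `I` iff its left half avoids the left-internal arcs of `I` and its right half the right-internal ones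
(in local coordinates). [folklore] -/
theorem glue2_avoids_iff (I : Finset (Fin (2 * (b + c)) × Fin (2 * (b + c))))
    (NL : Fin (2 * b) → Fin (2 * b)) (NR : Fin (2 * c) → Fin (2 * c)) :
    (∀ j ∈ openers (glue2 NL NR), (j, glue2 NL NR j) ∉ I) ↔
      (∀ j ∈ openers NL, blockEmb (two_mul_le b c) (j, NL j) ∉ I) ∧
        (∀ j ∈ openers NR, blockEmbR b c (j, NR j) ∉ I) := by
  constructor
  · intro h
    refine ⟨fun j hj => ?_, fun j hj => ?_⟩
    · have hop : Fin.castLE (two_mul_le b c) j ∈ openers (glue2 NL NR) := by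
        rw [mem_openers, glue2_castLE]
        exact (Fin.castLE_lt_castLE_iff _).2 (mem_openers.1 hj)
      have := h _ hop
      rw [glue2_castLE] at this
      exact this
    · have hop : shiftR b c j ∈ openers (glue2 NL NR) := by
        have hj' := mem_openers.1 hj
        rw [Fin.lt_def] at hj'
        rw [mem_openers, glue2_shiftR, Fin.lt_def, val_shiftR, val_shiftR]
        omega
      have := h _ hop
      rw [glue2_shiftR] at this
      exact this
  · rintro ⟨hL, hR⟩ j hj
    rcases eq_castLE_or_eq_shiftR j with ⟨j', rfl⟩ | ⟨j', rfl⟩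
    · rw [glue2_castLE]
      have hj' : j' ∈ openers NL := by
        rw [mem_openers] at hj ⊢
        rw [glue2_castLE] at hj
        exact (Fin.castLE_lt_castLE_iff _).1 hj
      exact hL j' hj'
    · rw [glue2_shiftR]
      have hj' : j' ∈ openers NR := by
        rw [mem_openers] at hj ⊢
        rw [glue2_shiftR, Fin.lt_def, val_shiftR, val_shiftR] at hj
        rw [Fin.lt_def]
        omega
      exact hR j' hj'

/-! ### §2 The split face of an avoiding family -/

/-- ★★ **`top_{𝟙_L}(NN_{b+c}^{¬I}) = ι_L(NN_b^{¬I_L}) · ι_R(NN_c^{¬I_R})`** whenever each block has a nest-free perfect matching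
avoiding its part of `I`. [cite: ChenDengDuStanleyYan2007, §1] -/
theorem topComponent_lWeight_avoidingFace (I : Finset (Fin (2 * (b + c)) × Fin (2 * (b + c))))
    (hL : ∃ NL ∈ nestFreeMatchings (2 * b), ∀ j ∈ openers NL, blockEmb (two_mul_le b c) (j, NL j) ∉ I)
    (hR : ∃ NR ∈ nestFreeMatchings (2 * c), ∀ j ∈ openers NR, blockEmbR b c (j, NR j) ∉ I) :
    topComponent (lWeight b c) (∑ M ∈ (nestFreeMatchings (2 * (b + c))).filter
        (fun M => ∀ j ∈ openers M, (j, M j) ∉ I), arcMonomial ℝ≥0 M) =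
      rename (blockEmb (two_mul_le b c)) (∑ NL ∈ (nestFreeMatchings (2 * b)).filter
          (fun NL => ∀ j ∈ openers NL, blockEmb (two_mul_le b c) (j, NL j) ∉ I), arcMonomial ℝ≥0 NL) *
        rename (blockEmbR b c) (∑ NR ∈ (nestFreeMatchings (2 * c)).filter
          (fun NR => ∀ j ∈ openers NR, blockEmbR b c (j, NR j) ∉ I), arcMonomial ℝ≥0 NR) := by
  classical
  obtain ⟨NL₀, hNL₀, hNL₀I⟩ := hL
  obtain ⟨NR₀, hNR₀, hNR₀I⟩ := hR
  set S := (nestFreeMatchings (2 * (b + c))).filter (fun M => ∀ j ∈ openers M, (j, M j) ∉ I) with hS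
  have hSsub : S ⊆ perfectMatchings (2 * (b + c)) :=
    (Finset.filter_subset _ _).trans nestFreeMatchings_subset_perfectMatchings
  have hG₀ := glue2_mem hNL₀ hNR₀
  have hG₀S : glue2 NL₀ NR₀ ∈ S :=
    Finset.mem_filter.2 ⟨hG₀, (glue2_avoids_iff I NL₀ NR₀).2 ⟨hNL₀I, hNR₀I⟩⟩
  have h1 : topComponent (lWeight b c) (∑ M ∈ S, arcMonomial ℝ≥0 M) =
      ∑ M ∈ S.filter (fun M => Finsupp.weight (lWeight b c) (arcExponent M) = b), arcMonomial ℝ≥0 M :=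
    topComponent_sum_arcMonomial (lWeight b c) hSsub (W := b) (fun M hM => weight_le (hSsub hM))
      ⟨_, hG₀S, (weight_eq_iff (nestFreeMatchings_subset_perfectMatchings hG₀)).2 (glue2_stable _ _)⟩
  have h2 : S.filter (fun M => Finsupp.weight (lWeight b c) (arcExponent M) = b) =
      (((nestFreeMatchings (2 * b)).filter
          (fun NL => ∀ j ∈ openers NL, blockEmb (two_mul_le b c) (j, NL j) ∉ I)) ×ˢ
        ((nestFreeMatchings (2 * c)).filter
          (fun NR => ∀ j ∈ openers NR, blockEmbR b c (j, NR j) ∉ I))).image (fun p => glue2 p.1 p.2) := by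
    ext M
    rw [Finset.mem_filter, hS, Finset.mem_filter, Finset.mem_image]
    constructor
    · rintro ⟨⟨hM, hMI⟩, hW⟩
      have hmax : M ∈ (nestFreeMatchings (2 * (b + c))).filter
          (fun M => Finsupp.weight (lWeight b c) (arcExponent M) = b) := Finset.mem_filter.2 ⟨hM, hW⟩
      rw [filter_max_eq_image, Finset.mem_image] at hmax
      obtain ⟨⟨NL, NR⟩, hp, hpM⟩ := hmax
      obtain ⟨hNL, hNR⟩ := Finset.mem_product.1 hp
      rw [← hpM] at hMI
      obtain ⟨hIL, hIR⟩ := (glue2_avoids_iff I NL NR).1 hMI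
      exact ⟨(NL, NR), Finset.mem_product.2 ⟨Finset.mem_filter.2 ⟨hNL, hIL⟩, Finset.mem_filter.2 ⟨hNR, hIR⟩⟩, hpM⟩
    · rintro ⟨⟨NL, NR⟩, hp, rfl⟩
      obtain ⟨hNL, hNR⟩ := Finset.mem_product.1 hp
      obtain ⟨hNL1, hNL2⟩ := Finset.mem_filter.1 hNL
      obtain ⟨hNR1, hNR2⟩ := Finset.mem_filter.1 hNR
      have hG := glue2_mem hNL1 hNR1
      exact ⟨⟨hG, (glue2_avoids_iff I NL NR).2 ⟨hNL2, hNR2⟩⟩,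
        (weight_eq_iff (nestFreeMatchings_subset_perfectMatchings hG)).2 (glue2_stable _ _)⟩
  rw [h1, h2, Finset.sum_image fun p _ q _ h => Prod.ext (glue2_injective2 h).1 (glue2_injective2 h).2,
    Finset.sum_product, map_sum, map_sum, Finset.sum_mul_sum]
  exact Finset.sum_congr rfl fun NL _ => Finset.sum_congr rfl fun NR _ => arcMonomial_glue2 NL NR

/-! ### §3 One step of the block recursion -/

/-- A filtered sum of arc monomials with a member is nonzero. [folklore] -/
theorem sum_arcMonomial_ne_zero {m : ℕ} {T : Finset (Fin m → Fin m)} (hT : T ⊆ perfectMatchings m)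
    {M : Fin m → Fin m} (hM : M ∈ T) : (∑ N ∈ T, arcMonomial ℝ≥0 N) ≠ 0 := by
  classical
  rw [← support_nonempty, support_sum_arcMonomial hT]
  exact ⟨arcExponent M, Finset.mem_image.2 ⟨M, hM, rfl⟩⟩

/-- ★★ **LEFT STEP: `L₊(NN_b^{¬I_L}) ≤ L₊(NN_{b+c}^{¬I}) + 3`.** [cite: Burgisser2000, Rem. 2.7] -/
theorem complexity_faceL_le (I : Finset (Fin (2 * (b + c)) × Fin (2 * (b + c))))
    (hL : ∃ NL ∈ nestFreeMatchings (2 * b), ∀ j ∈ openers NL, blockEmb (two_mul_le b c) (j, NL j) ∉ I)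
    (hR : ∃ NR ∈ nestFreeMatchings (2 * c), ∀ j ∈ openers NR, blockEmbR b c (j, NR j) ∉ I) :
    complexity (∑ NL ∈ (nestFreeMatchings (2 * b)).filter
        (fun NL => ∀ j ∈ openers NL, blockEmb (two_mul_le b c) (j, NL j) ∉ I), arcMonomial ℝ≥0 NL) ≤
      complexity (∑ M ∈ (nestFreeMatchings (2 * (b + c))).filter
        (fun M => ∀ j ∈ openers M, (j, M j) ∉ I), arcMonomial ℝ≥0 M) + 3 := by
  obtain ⟨NR₀, hNR₀, hNR₀I⟩ := hR
  have hFR : (∑ NR ∈ (nestFreeMatchings (2 * c)).filter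
      (fun NR => ∀ j ∈ openers NR, blockEmbR b c (j, NR j) ∉ I), arcMonomial ℝ≥0 NR) ≠ 0 :=
    sum_arcMonomial_ne_zero ((Finset.filter_subset _ _).trans nestFreeMatchings_subset_perfectMatchings)
      (Finset.mem_filter.2 ⟨hNR₀, hNR₀I⟩)
  have hR0 : rename (blockEmbR b c) (∑ NR ∈ (nestFreeMatchings (2 * c)).filter
      (fun NR => ∀ j ∈ openers NR, blockEmbR b c (j, NR j) ∉ I), arcMonomial ℝ≥0 NR) ≠ 0 := fun h0 =>
    hFR (rename_injective _ blockEmbR_injective (by rw [h0, map_zero]))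
  have H := complexity_le_of_vars_outside (blockEmb_injective (two_mul_le b c)) (lWeight b c)
    (topComponent_lWeight_avoidingFace I hL ⟨NR₀, hNR₀, hNR₀I⟩) hR0 (support_rename_blockEmbR_outside _)
    (h := (1 : MvPolynomial (Fin (2 * (b + c)) × Fin (2 * (b + c))) ℝ≥0)) one_ne_zero
    (fun v hv => by simp [vars_one] at hv)
  rw [mul_one] at H
  omega

/-- ★★ **RIGHT STEP: `L₊(NN_c^{¬I_R}) ≤ L₊(NN_{b+c}^{¬I}) + 3`.** [cite: Burgisser2000, Rem. 2.7] -/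
theorem complexity_faceR_le (I : Finset (Fin (2 * (b + c)) × Fin (2 * (b + c))))
    (hL : ∃ NL ∈ nestFreeMatchings (2 * b), ∀ j ∈ openers NL, blockEmb (two_mul_le b c) (j, NL j) ∉ I)
    (hR : ∃ NR ∈ nestFreeMatchings (2 * c), ∀ j ∈ openers NR, blockEmbR b c (j, NR j) ∉ I) :
    complexity (∑ NR ∈ (nestFreeMatchings (2 * c)).filter
        (fun NR => ∀ j ∈ openers NR, blockEmbR b c (j, NR j) ∉ I), arcMonomial ℝ≥0 NR) ≤
      complexity (∑ M ∈ (nestFreeMatchings (2 * (b + c))).filter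
        (fun M => ∀ j ∈ openers M, (j, M j) ∉ I), arcMonomial ℝ≥0 M) + 3 := by
  obtain ⟨NL₀, hNL₀, hNL₀I⟩ := hL
  have hFL : (∑ NL ∈ (nestFreeMatchings (2 * b)).filter
      (fun NL => ∀ j ∈ openers NL, blockEmb (two_mul_le b c) (j, NL j) ∉ I), arcMonomial ℝ≥0 NL) ≠ 0 :=
    sum_arcMonomial_ne_zero ((Finset.filter_subset _ _).trans nestFreeMatchings_subset_perfectMatchings)
      (Finset.mem_filter.2 ⟨hNL₀, hNL₀I⟩)
  have hL0 : rename (blockEmb (two_mul_le b c)) (∑ NL ∈ (nestFreeMatchings (2 * b)).filter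
      (fun NL => ∀ j ∈ openers NL, blockEmb (two_mul_le b c) (j, NL j) ∉ I), arcMonomial ℝ≥0 NL) ≠ 0 := fun h0 =>
    hFL (rename_injective _ (blockEmb_injective (two_mul_le b c)) (by rw [h0, map_zero]))
  have H := complexity_le_of_vars_outside blockEmbR_injective (lWeight b c)
    ((topComponent_lWeight_avoidingFace I ⟨NL₀, hNL₀, hNL₀I⟩ hR).trans (mul_comm _ _)) hL0
    (support_rename_blockEmb_outside _)
    (h := (1 : MvPolynomial (Fin (2 * (b + c)) × Fin (2 * (b + c))) ℝ≥0)) one_ne_zero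
    (fun v hv => by simp [vars_one] at hv)
  rw [mul_one] at H
  omega

/-! ### §4 The mixed tier: left-short ∪ crossing ∪ right-avoidable -/

/-- ★★ **MIXED FACES, stretched-exponential form.**  Eventually in `b`: for every `c` and every arc set `I` of `[0, 2(b+c))`
whose left-internal arcs are short at scale `b` (`(j − i)³ ≤ b²`) and whose right-internal arcs are avoided by some nest-free
perfect matching of the right block (arcs crossing `2b` unrestricted), `2^{b^{1/6}} ≤ L₊(NN_{b+c}^{¬I}) + 4`.
[cite: HrubesYehudayoff2021, §6 Problem 2] -/
theorem mixedFace_exp_lower_bound : ∃ b₀ : ℕ, ∀ b : ℕ, b₀ ≤ b → ∀ c : ℕ,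
    ∀ I : Finset (Fin (2 * (b + c)) × Fin (2 * (b + c))),
    (∀ e ∈ I, (e.1 : ℕ) < 2 * b → (e.2 : ℕ) < 2 * b → ((e.2 : ℕ) - (e.1 : ℕ)) ^ 3 ≤ b ^ 2) →
    (∃ NR ∈ nestFreeMatchings (2 * c), ∀ j ∈ openers NR, blockEmbR b c (j, NR j) ∉ I) →
      (2 : ℝ) ^ ((b : ℝ) ^ ((1 : ℝ) / 6)) ≤
        ((complexity (∑ M ∈ (nestFreeMatchings (2 * (b + c))).filter
          (fun M => ∀ j ∈ openers M, (j, M j) ∉ I), arcMonomial ℝ≥0 M) + 4 : ℕ) : ℝ) := by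
  classical
  obtain ⟨b₀, hb₀⟩ := shortFaces_exp_lower_bound
  refine ⟨max b₀ 2, fun b hb c I hshort hR => ?_⟩
  have hb0 : b₀ ≤ b := le_trans (le_max_left _ _) hb
  have hb2 : 2 ≤ b := le_trans (le_max_right _ _) hb
  -- the left-internal arcs of `I`, in local coordinates
  set IL : Finset (Fin (2 * b) × Fin (2 * b)) :=
    Finset.univ.filter (fun a => blockEmb (two_mul_le b c) a ∈ I) with hIL
  have hILshort : ∀ a ∈ IL, ((a.2 : ℕ) - (a.1 : ℕ)) ^ 3 ≤ b ^ 2 := by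
    intro a ha
    rw [hIL, Finset.mem_filter] at ha
    have h := hshort _ ha.2
    simp only [blockEmb, Prod.map_fst, Prod.map_snd, Fin.val_castLE] at h
    exact h a.1.isLt a.2.isLt
  have hfilt : ∀ NL : Fin (2 * b) → Fin (2 * b),
      (∀ j ∈ openers NL, blockEmb (two_mul_le b c) (j, NL j) ∉ I) ↔ (∀ j ∈ openers NL, (j, NL j) ∉ IL) := by
    intro NL
    simp only [hIL, Finset.mem_filter, Finset.mem_univ, true_and]
  have hL : ∃ NL ∈ nestFreeMatchings (2 * b), ∀ j ∈ openers NL, blockEmb (two_mul_le b c) (j, NL j) ∉ I :=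
    ⟨shiftMatching b, shiftMatching_mem b, (hfilt _).2 (shift_avoids_short hb2 hILshort)⟩
  have hstep := complexity_faceL_le I hL hR
  have hface := hb₀ b hb0 IL hILshort
  have heq : (∑ NL ∈ (nestFreeMatchings (2 * b)).filter
      (fun NL => ∀ j ∈ openers NL, blockEmb (two_mul_le b c) (j, NL j) ∉ I), arcMonomial ℝ≥0 NL) =
      ∑ NL ∈ (nestFreeMatchings (2 * b)).filter (fun NL => ∀ j ∈ openers NL, (j, NL j) ∉ IL), arcMonomial ℝ≥0 NL :=
    Finset.sum_congr (Finset.filter_congr fun NL _ => hfilt NL) fun _ _ => rfl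
  rw [heq] at hstep
  refine hface.trans ?_
  exact_mod_cast (Nat.add_le_add_right hstep 1).trans (by omega)

/-- ★★ **MIXED-GENERIC COFACTORS ARE NOT CERTIFICATES.**  For every `c₀`, eventually in `n`: let `n = b + c` with `c ≤ b`, and
let `I` be an arc set whose left-internal arcs are short at scale `b`, whose right-internal arcs are avoided by some
nest-free perfect matching of the right block, and which is avoided by some nest-free perfect matching of `[0, 2n)`; if the
outer face `top_{𝟙_{I^c}} h` is a single monomial `a · x^d` (`a ≠ 0`) then `2^((log₂ n + c₀)^c₀) < L₊(NN_n · h) + L₊(h)`.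
[cite: HrubesYehudayoff2021, §6 Problem 2] [cite: JuknaSeiwertSergeev2022, Thm 1] -/
theorem mixedGeneric_not_certificate_qp (c₀ : ℕ) : ∃ n₀ : ℕ, ∀ b c : ℕ, n₀ ≤ b + c → c ≤ b →
    ∀ I : Finset (Fin (2 * (b + c)) × Fin (2 * (b + c))),
    (∀ e ∈ I, (e.1 : ℕ) < 2 * b → (e.2 : ℕ) < 2 * b → ((e.2 : ℕ) - (e.1 : ℕ)) ^ 3 ≤ b ^ 2) →
    (∃ NR ∈ nestFreeMatchings (2 * c), ∀ j ∈ openers NR, blockEmbR b c (j, NR j) ∉ I) →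
    (∃ M ∈ nestFreeMatchings (2 * (b + c)), ∀ j ∈ openers M, (j, M j) ∉ I) →
    ∀ (h : MvPolynomial (Fin (2 * (b + c)) × Fin (2 * (b + c))) ℝ≥0) (d : (Fin (2 * (b + c)) × Fin (2 * (b + c))) →₀ ℕ)
      (a : ℝ≥0), a ≠ 0 →
      topComponent (fun v : Fin (2 * (b + c)) × Fin (2 * (b + c)) => if v ∈ I then 0 else 1) h = monomial d a →
      2 ^ ((Nat.log 2 (b + c) + c₀) ^ c₀) <
        complexity (nestFreeMatchingPoly (b + c) ℝ≥0 * h) + complexity h := by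
  set K : ℕ := c₀ + 14 with hK
  obtain ⟨b₁, hb₁⟩ := mixedFace_exp_lower_bound
  obtain ⟨n₃, hn₃⟩ := polylog_lt_rpow_half_eventually (K + 2)
  refine ⟨max (2 * b₁) n₃, fun b c hn hcb I hshort hR hIav h d a ha htop => ?_⟩
  have hb1 : b₁ ≤ b := by have := le_trans (le_max_left _ _) hn; omega
  have hn3 : n₃ ≤ b + c := le_trans (le_max_right _ _) hn
  set F := complexity (∑ M ∈ (nestFreeMatchings (2 * (b + c))).filter
      (fun M => ∀ j ∈ openers M, (j, M j) ∉ I), arcMonomial ℝ≥0 M) with hF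
  have hface : F ≤ 16 * ((2 * (b + c) + 1) * (complexity (nestFreeMatchingPoly (b + c) ℝ≥0 * h) + 2)) ^ 2 :=
    complexity_avoidingFace_le_of_top_monomial I hIav ha htop
  set L := complexity (nestFreeMatchingPoly (b + c) ℝ≥0 * h) with hL
  by_contra hle
  push Not at hle
  have hLle : L ≤ 2 ^ ((Nat.log 2 (b + c) + c₀) ^ c₀) := le_trans (Nat.le_add_right _ _) hle
  have e1 := absorb_arith (b + c) c₀ L hLle
  have e3 : 2 ^ (2 * (Nat.log 2 (b + c) + c₀) ^ c₀ + 2 * Nat.log 2 (b + c) + 13) ≤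
      2 ^ ((Nat.log 2 (b + c) + K) ^ K) := Nat.pow_le_pow_right (by norm_num) (absorb_exp (Nat.log 2 (b + c)) c₀)
  have h7 : 16 * ((2 * (b + c) + 1) * (L + 2)) ^ 2 + 1 ≤ 2 ^ ((Nat.log 2 (b + c) + K) ^ K) := e1.trans e3
  have hp : (Nat.log 2 (b + c) + K) ^ K + 2 ≤ (Nat.log 2 (b + c) + (K + 2)) ^ (K + 2) := by
    have h1 : (Nat.log 2 (b + c) + K) ^ K ≤ (Nat.log 2 (b + c) + (K + 2)) ^ K := Nat.pow_le_pow_left (by omega) K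
    have h2 : 1 ≤ (Nat.log 2 (b + c) + (K + 2)) ^ K := Nat.one_le_pow _ _ (by omega)
    have h3 : 2 ^ 2 ≤ (Nat.log 2 (b + c) + (K + 2)) ^ 2 := Nat.pow_le_pow_left (by omega) 2
    have h4 : 3 * (Nat.log 2 (b + c) + (K + 2)) ^ K ≤
        (Nat.log 2 (b + c) + (K + 2)) ^ K * (Nat.log 2 (b + c) + (K + 2)) ^ 2 := by
      rw [mul_comm]
      exact Nat.mul_le_mul_left _ (by norm_num at h3; omega)
    calc (Nat.log 2 (b + c) + K) ^ K + 2 ≤ 3 * (Nat.log 2 (b + c) + (K + 2)) ^ K := by omega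
      _ ≤ (Nat.log 2 (b + c) + (K + 2)) ^ K * (Nat.log 2 (b + c) + (K + 2)) ^ 2 := h4
      _ = (Nat.log 2 (b + c) + (K + 2)) ^ (K + 2) := by rw [← pow_add]
  have h8 : 16 * ((2 * (b + c) + 1) * (L + 2)) ^ 2 + 4 ≤ 2 ^ ((Nat.log 2 (b + c) + (K + 2)) ^ (K + 2)) := by
    calc 16 * ((2 * (b + c) + 1) * (L + 2)) ^ 2 + 4 ≤ 4 * (16 * ((2 * (b + c) + 1) * (L + 2)) ^ 2 + 1) := by omega
      _ ≤ 4 * 2 ^ ((Nat.log 2 (b + c) + K) ^ K) := Nat.mul_le_mul_left 4 h7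
      _ = 2 ^ ((Nat.log 2 (b + c) + K) ^ K + 2) := by rw [pow_add]; ring
      _ ≤ 2 ^ ((Nat.log 2 (b + c) + (K + 2)) ^ (K + 2)) := Nat.pow_le_pow_right (by norm_num) hp
  have hexp := hb₁ b hb1 c I hshort hR
  have h2 := hn₃ (b + c) hn3 b (by omega)
  have h3 : (2 : ℝ) ^ ((((Nat.log 2 (b + c) + (K + 2)) ^ (K + 2) : ℕ) : ℝ)) < (2 : ℝ) ^ ((b : ℝ) ^ ((1 : ℝ) / 6)) :=
    Real.rpow_lt_rpow_of_exponent_lt (by norm_num) h2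
  have h4 : ((2 ^ ((Nat.log 2 (b + c) + (K + 2)) ^ (K + 2)) : ℕ) : ℝ) < ((F + 4 : ℕ) : ℝ) := by
    rw [Nat.cast_pow, Nat.cast_ofNat, ← Real.rpow_natCast]
    exact h3.trans_le hexp
  have h5 : 2 ^ ((Nat.log 2 (b + c) + (K + 2)) ^ (K + 2)) < F + 4 := by exact_mod_cast h4
  have h9 : F + 4 ≤ 16 * ((2 * (b + c) + 1) * (L + 2)) ^ 2 + 4 := Nat.add_le_add_right hface 4
  exact absurd (lt_of_lt_of_le h5 (h9.trans h8)) (lt_irrefl _)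

end Split

end Summit.ValiantsHypothesis.ValiantsHypothesis.Theorems.FifoMatching.NNDivisionHard.SplitFaceAvoiding

end
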